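import Summits.CriticalPhenomena.PercolationContinuityZ3.Theorems.PercNearOneGluingNoHeavyQuantCatHullCertDataR8
import Summits.CriticalPhenomena.PercolationContinuityZ3.Theorems.PercNearOneGluingNoHeavyQuantCatHullCertChkR8Leaf59s0
import Summits.CriticalPhenomena.PercolationContinuityZ3.Theorems.PercNearOneGluingNoHeavyQuantCatHullCertChkR8Leaf59s1
import Summits.CriticalPhenomena.PercolationContinuityZ3.Theorems.PercNearOneGluingNoHeavyQuantCatHullCertChkR8Leaf59s2
import Summits.CriticalPhenomena.PercolationContinuityZ3.Theorems.PercNearOneGluingNoHeavyQuantCatHullCertChkR8Leaf59s3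
import Summits.CriticalPhenomena.PercolationContinuityZ3.Theorems.PercNearOneGluingNoHeavyQuantCatHullCertChkR8Leaf59s4
import Summits.CriticalPhenomena.PercolationContinuityZ3.Theorems.PercNearOneGluingNoHeavyQuantCatHullCertChkR8Leaf59s5
import HarnessLib

/-!
# QUANT lane R8, T-DEC: LEAF CHECKS of certificate `R8`, assembling file 59

builds on p205010 (kernel theorem, internal audit signed; external expert review pending)

Computational support file (`--supports stmt-CriticalPhenomena-4575`, `--computational`), census seat prim-quant-census-2 (gen 78): kernel
evaluation (`native_decide`) of parts of `CertData.check2` for the certificate `certDataR8` (memo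
`run/shared/lean/prim/quant/prim-quant-census-2-g78/BELLMAN-G78.md`).  Heavy leaves are split into `G`-strips / sub-boxes (`…QuantCatHullLeafPieces`).  [this work].  Nothing here is cited as a published result.  The gluing rows served [cite: KozmaNitzan2024, Conjecture 3 (p. 15)]; product measure [cite: Grimmett1999, §1.3 p. 10].
-/

noncomputable section

namespace Summit.CriticalPhenomena.PercolationContinuityZ3.Theorems
namespace Quant
namespace LawDec
open Tab

/-- leaf check `(u,a)=(1,5)`, atoms `(0,4,11)`, mode `seg` passes (from its 12 strips). [this work] -/
theorem certR8Leaf_1_5_seg : leafChk certDataR8.ψq certDataR8.y (certDataR8.Tu 1) certDataR8.fuel 1 5 0 4 11 Mode.seg = true :=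
  leafChk_of_strips (n := 12) (by decide) fun k hk => by
    interval_cases k <;> first | exact certR8Leaf_1_5_seg_k0 | exact certR8Leaf_1_5_seg_k1 | exact certR8Leaf_1_5_seg_k2 | exact certR8Leaf_1_5_seg_k3 | exact certR8Leaf_1_5_seg_k4 | exact certR8Leaf_1_5_seg_k5 | exact certR8Leaf_1_5_seg_k6 | exact certR8Leaf_1_5_seg_k7 | exact certR8Leaf_1_5_seg_k8 | exact certR8Leaf_1_5_seg_k9 | exact certR8Leaf_1_5_seg_k10 | exact certR8Leaf_1_5_seg_k11


end LawDec
end Quant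
end Summit.CriticalPhenomena.PercolationContinuityZ3.Theorems
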